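/-
Copyright (c) 2026 the pub-hodgecm-mathlib formalisation cell (harness21).  Prover seat hodgecm-mathlib-K2E1b-p04 (g0),
Track B «K2-LIT» ∕ h413, unit U0 «TWIST INTEGRATION» of the line `K2_E1b_GKCohomologyU21`, file #6: payment of the socket
`K2E1bGKCohomologyU21.U0.sig_K2E1bTwistAdmissible` — A `(𝔤, K)`-MODULE OF `U(2,1)` WHOSE `𝔨`-ACTION IS GIVEN BY THE
TWISTED `u`-BASIS FORMULAS IS ADMISSIBLE.  2026-09-03.
-/
import Summits.HodgeConjecture.HodgeConjecture.Theorems.K2E1bKTypeTwistDefs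
import Literature.NumberTheory.Automorphic.GKModulesAdmissibleOfEigenspaces
import HarnessLib

/-!
# K2_E1b road (h413 = stmt-HodgeConjecture-24833), unit U0 «twist integration», file #6:
# admissibility of a `(𝔤, K)`-module of `U(2,1)` carrying Kovačević's twisted `u`-basis formulas on `𝔨`

Cell `pub/hodgecm-mathlib` (D-0151), Track B (21-frontier RULING «PUSH BOTH» 2026-09-03, director req621∕req624, chair
K2-lead ORDER #1 §4.4 ∕ ORDER #2 ∕ ★ KEY AMENDMENT `--as helper`), socket module
`Summits/HodgeConjecture/HodgeConjecture/Cruxes/H413/Lines/K2_E1b_GKCohomologyU21_U0_TwistIntegration.lean` (planner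
K2E1b-plan (g0), ED. 2), socket **`sig_K2E1bTwistAdmissible`** (#6, size M): for a `K`-type datum `S ⊂ ℤ²`, a central
exponent `e`, a `K`-action `ρK` and a real Lie action `ρ𝔤` of `𝔲(2,1)` on `V = ⊕_{(n,m) ∈ S} V_{n,m}` (`KIdx S →₀ ℂ`,
basis `u^k_{n,m} = kvec S n m k`, `1 ≤ k ≤ n`) forming a `(𝔤, K)`-module (`IsGKModule`) whose restriction to
`𝔨 = 𝔲(2) ⊕ 𝔲(1)` acts by the TWISTED `u`-basis formulas (★ `ActsOnKTypesTwist S e ρ𝔤`, defs leaf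
`Theorems/K2E1bKTypeTwistDefs`), the `K`-action is ADMISSIBLE (`IsAdmissibleGK ρK`: every irreducible `K`-type has
finite multiplicity).  The socket's hypotheses «`1 ≤ n` on `S`» and «`ρK` preserves every `V_{n,m}`» are not used.

THE MATHEMATICS (Borel–Wallach 0 §2.4–2.5; Knapp–Vogan §I.3 before Prop. 1.63: admissible = each `K`-type has finite
multiplicity).  Admissibility is read off ONE diagonalisable element of the (associative) `𝔨`-algebra with
finite-dimensional eigenspaces — the tree's ★ `IsGKModule.isAdmissibleGK_of_basis_eigenvector`
(`Literature/NumberTheory/Automorphic/GKModulesAdmissibleOfEigenspaces`).  With `H' = diag(i, −i | 0)`,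
`Z' = diag(i, i | −2i)`, `Y₁ = E₀₁ − E₁₀`, `Y₂ = i(E₀₁ + E₁₀)` in `𝔨` (all traceless, so the central twist `(e∕3)·tr`
is invisible), the twisted formulas give on `u^k = u^k_{n,m}`:
`H' u^k = i(n+1−2k) u^k`, `Z' u^k = i m u^k`, `(Y₁ − iY₂) u^k = −2(k−1)(n+1−k) u^{k−1}`, `(Y₁ + iY₂) u^k = 2 u^{k+1}`
(§2), hence the `𝔰𝔲(2)`-Casimir-type element `T₀ = (Y₁ + iY₂)(Y₁ − iY₂) + H'² + 2i H'` acts on `u^k_{n,m}` by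
`−4(k−1)(n+1−k) − (n+1−2k)² − 2(n+1−2k) = 1 − n²` (§3: it is `−(p+q)(p+q+2)` with `p = k−1`, `q = n−k`), and
`T = T₀ + Z'` acts DIAGONALLY on the basis `u^k_{n,m}` with eigenvalue `(1 − n²) + i m`.  Since `n ≥ 1`, the eigenvalue
determines `(n, m)`, and `k` ranges over `1 … n`: every fibre is finite (§4), so ★ applies (§5).  The complex scalars
`±i`, `2i` enter through `algebraMap ℂ (End V)`, so that membership of `T` in the `𝔨`-algebra is `add_mem`∕`mul_mem`∕
`algebraMap_mem` only.  This is the twisted (`e ≠ 0`) companion of ★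
`F0P3bKovLieTransports.isAdmissibleGK_kovLie_of_weightBasis` (there ONE weight `Z` suffices because Kovačević's rays
have finitely many `n` per `m`; for an ARBITRARY datum `S` the `𝔰𝔲(2)`-Casimir is needed to pin `n`).

* §1 the four generators `H'`, `Z'`, `Y₁`, `Y₂` as elements of `𝔨 = (uFormGroup (Fin 2) (Fin 1)).compactLie`
  (★ `upq_fromBlocks_mem_compactLie`);
* §2 their action on `u^k_{n,m}` from `ActsOnKTypesTwist` (entries of block matrices; `match_scalars`);
* §3 the diagonal element `T` and its eigenvalue `(1 − n²) + i m`; membership of `T` in the `𝔨`-algebra;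
* §4 finiteness of the fibres of `(n, m, k) ↦ (1 − n²) + i m` on `KIdx S`;
* §5 **`twistAdmissible`** — `sig_K2E1bTwistAdmissible` TOKEN FOR TOKEN (home probe
  `example : type_of% @twistAdmissible = type_of% @K2E1bGKCohomologyU21.U0.sig_K2E1bTwistAdmissible := rfl`,
  `K2/K2E1b-p04/g0/Probe_K2E1bTwistAdmissible.lean`).

Mathlib ∕ tree search: `IsAdmissibleGK`, `IsGKModule` (★ `GKModules`); `IsGKModule.isAdmissibleGK_of_basis_eigenvector`
(★, reused by name); `upq_fromBlocks_mem_compactLie` (★ `UpqMaximalCompactExp`); `kvec`, `KIdx`, `single_eq_kvec`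
(★ `F0P3bKTypeIntegration`); Mathlib `Finsupp.basisSingleOne`, `Algebra.subset_adjoin`,
`Subalgebra.mul_mem ∕ add_mem ∕ algebraMap_mem`, `Module.algebraMap_end_apply`, `Set.Finite.of_finite_image`,
`Set.finite_Icc`, `Mathlib.Tactic.Module` (`match_scalars`), `linear_combination` with `Complex.I_sq`.
Dedup: `lean search 'isAdmissibleGK_of'` — nothing for twisted `K`-type data; the `e = 0` ladder case is ★
`F0P3bKovacevicTransports`.

HONEST LABEL: HC_CM is proved only modulo the 7 printed citations (2 remaining named inputs: hLiu418 =
stmt-HodgeConjecture-24832, h413 = stmt-HodgeConjecture-24833) until rung 0 closes; this file is a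
`--supports stmt-HodgeConjecture-24833 --as helper` brick (socket #6 of the K2_E1b road) and retires nothing by itself.
-/

set_option autoImplicit false
-- `Summit.HodgeConjecture.HodgeConjecture.…` is the tree's problem-side namespace (summit = problem): duplication by design
set_option linter.dupNamespace false

noncomputable section

open scoped Matrix

namespace Summit.HodgeConjecture.HodgeConjecture.Cruxes.H413.K2E1bTwistAdmissible

open Literature.NumberTheory.Automorphic
open Literature.RepresentationTheory.BorelWallach2000
open Literature.RepresentationTheory.KonnoKonno2007 Literature.RepresentationTheory.KonnoKonno2007.RealDualPair
open Literature.RepresentationTheory.KonnoKonno2007.RealDualPair.UForm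
open Summit.HodgeConjecture.HodgeConjecture.Cruxes.H413.F0P3bKTypeIntegration (KIdx kvec single_eq_kvec)
open Summit.HodgeConjecture.HodgeConjecture.Cruxes.H413.K2E1bGKCohomologyU21 (ActsOnKTypesTwist)
open Complex (I)

-- Mathlib idiom (Mathlib's own `Algebra/Lie/OfAssociative`, ★ `GKModules`, the `Upq*` files, ★ `F0P3bKovLieTransports`,
-- the defs leaf ★ `K2E1bKTypeTwistDefs`): `LieRing.ofAssociativeRing` is a `def` in Mathlib, and the commutator bracket on
-- `Module.End` is needed to even state the socket's binder `ρ𝔤 : 𝔤 →ₗ⁅ℝ⁆ Module.End ℂ V`; no library instance is overridden.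
attribute [local instance 100] LieRing.ofAssociativeRing

/-! ## §1 Four elements of `𝔨 = 𝔲(2) ⊕ 𝔲(1)` -/

/-- `diag(i, −i)` is skew-Hermitian. [folklore] -/
theorem conjTranspose_diagH : (!![I, 0; 0, -I] : Matrix (Fin 2) (Fin 2) ℂ)ᴴ = -!![I, 0; 0, -I] := by
  ext i j; fin_cases i <;> fin_cases j <;> simp [Matrix.conjTranspose_apply]

/-- `diag(i, i)` is skew-Hermitian. [folklore] -/
theorem conjTranspose_diagZ : (!![I, 0; 0, I] : Matrix (Fin 2) (Fin 2) ℂ)ᴴ = -!![I, 0; 0, I] := by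
  ext i j; fin_cases i <;> fin_cases j <;> simp [Matrix.conjTranspose_apply]

/-- the `1 × 1` matrix `(−2i)` is skew-Hermitian. [folklore] -/
theorem conjTranspose_negTwoI : (!![-2 * I] : Matrix (Fin 1) (Fin 1) ℂ)ᴴ = -!![-2 * I] := by
  ext i j; fin_cases i; fin_cases j; simp [Matrix.conjTranspose_apply]

/-- `E₀₁ − E₁₀` is skew-Hermitian. [folklore] -/
theorem conjTranspose_Y₁ : (!![0, 1; -1, 0] : Matrix (Fin 2) (Fin 2) ℂ)ᴴ = -!![0, 1; -1, 0] := by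
  ext i j; fin_cases i <;> fin_cases j <;> simp [Matrix.conjTranspose_apply]

/-- `i(E₀₁ + E₁₀)` is skew-Hermitian. [folklore] -/
theorem conjTranspose_Y₂ : (!![0, I; I, 0] : Matrix (Fin 2) (Fin 2) ℂ)ᴴ = -!![0, I; I, 0] := by
  ext i j; fin_cases i <;> fin_cases j <;> simp [Matrix.conjTranspose_apply]

/-- **`H' = diag(i, −i | 0) ∈ 𝔨`** (Kovačević's `i·H_α`). [cite: Knapp2002, I §1 Example (3)] -/
theorem exists_compactLie_H : ∃ X : (uFormGroup (Fin 2) (Fin 1)).compactLie,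
    (X : Matrix (Fin 2 ⊕ Fin 1) (Fin 2 ⊕ Fin 1) ℂ) = Matrix.fromBlocks !![I, 0; 0, -I] 0 0 0 :=
  ⟨⟨_, upq_fromBlocks_mem_compactLie conjTranspose_diagH (by simp)⟩, rfl⟩

/-- **`Z' = diag(i, i | −2i) ∈ 𝔨`** (Kovačević's `i·Z = i(H_α + 2H_β)`, traceless). [cite: Knapp2002, I §1 Example (3)] -/
theorem exists_compactLie_Z : ∃ X : (uFormGroup (Fin 2) (Fin 1)).compactLie,
    (X : Matrix (Fin 2 ⊕ Fin 1) (Fin 2 ⊕ Fin 1) ℂ) = Matrix.fromBlocks !![I, 0; 0, I] 0 0 !![-2 * I] :=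
  ⟨⟨_, upq_fromBlocks_mem_compactLie conjTranspose_diagZ conjTranspose_negTwoI⟩, rfl⟩

/-- **`Y₁ = E₀₁ − E₁₀ ∈ 𝔨`**. [cite: Knapp2002, I §1 Example (3)] -/
theorem exists_compactLie_Y₁ : ∃ X : (uFormGroup (Fin 2) (Fin 1)).compactLie,
    (X : Matrix (Fin 2 ⊕ Fin 1) (Fin 2 ⊕ Fin 1) ℂ) = Matrix.fromBlocks !![0, 1; -1, 0] 0 0 0 :=
  ⟨⟨_, upq_fromBlocks_mem_compactLie conjTranspose_Y₁ (by simp)⟩, rfl⟩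

/-- **`Y₂ = i(E₀₁ + E₁₀) ∈ 𝔨`**. [cite: Knapp2002, I §1 Example (3)] -/
theorem exists_compactLie_Y₂ : ∃ X : (uFormGroup (Fin 2) (Fin 1)).compactLie,
    (X : Matrix (Fin 2 ⊕ Fin 1) (Fin 2 ⊕ Fin 1) ℂ) = Matrix.fromBlocks !![0, I; I, 0] 0 0 0 :=
  ⟨⟨_, upq_fromBlocks_mem_compactLie conjTranspose_Y₂ (by simp)⟩, rfl⟩

/-! ## §2 The twisted `u`-basis formulas on the four generators -/

section Action

variable {S : Set (ℤ × ℤ)} {e : ℤ} {ρ𝔤 : (uFormGroup (Fin 2) (Fin 1)).lie →ₗ⁅ℝ⁆ Module.End ℂ (KIdx S →₀ ℂ)}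

/-- **`H' u^k = i(n+1−2k) u^k`** (the `H_α`-weight; `H'` is traceless, so no twist). [cite: Kovacevic2021, §3 Def. 1] -/
theorem act_H (hρ : ActsOnKTypesTwist S e ρ𝔤) {X : (uFormGroup (Fin 2) (Fin 1)).compactLie}
    (hX : (X : Matrix (Fin 2 ⊕ Fin 1) (Fin 2 ⊕ Fin 1) ℂ) = Matrix.fromBlocks !![I, 0; 0, -I] 0 0 0)
    {n m k : ℤ} (hS : (n, m) ∈ S) (hk : 1 ≤ k) (hkn : k ≤ n) :
    ρ𝔤 (LieSubalgebra.inclusion (uFormGroup (Fin 2) (Fin 1)).compactLie_le_lie X) (kvec S n m k) =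
      (I * ((n : ℂ) + 1 - 2 * k)) • kvec S n m k := by
  rw [hρ X n m k hS hk hkn, hX]
  simp only [Fin.isValue, Matrix.fromBlocks_apply₁₁, Matrix.fromBlocks_apply₂₂, Matrix.of_apply, Matrix.cons_val',
    Matrix.cons_val_zero, Matrix.cons_val_one, Matrix.cons_val_fin_one, Matrix.zero_apply]
  match_scalars <;> ring

/-- **`Z' u^k = i m u^k`** (Kovačević's `Z = H_α + 2H_β` acts on `V_{n,m}` by `m`; `Z'` is traceless, so no twist).
[cite: Kovacevic2021, §3 Def. 1] -/
theorem act_Z (hρ : ActsOnKTypesTwist S e ρ𝔤) {X : (uFormGroup (Fin 2) (Fin 1)).compactLie}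
    (hX : (X : Matrix (Fin 2 ⊕ Fin 1) (Fin 2 ⊕ Fin 1) ℂ) = Matrix.fromBlocks !![I, 0; 0, I] 0 0 !![-2 * I])
    {n m k : ℤ} (hS : (n, m) ∈ S) (hk : 1 ≤ k) (hkn : k ≤ n) :
    ρ𝔤 (LieSubalgebra.inclusion (uFormGroup (Fin 2) (Fin 1)).compactLie_le_lie X) (kvec S n m k) =
      (I * (m : ℂ)) • kvec S n m k := by
  rw [hρ X n m k hS hk hkn, hX]
  simp only [Fin.isValue, Matrix.fromBlocks_apply₁₁, Matrix.fromBlocks_apply₂₂, Matrix.of_apply, Matrix.cons_val',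
    Matrix.cons_val_zero, Matrix.cons_val_one, Matrix.cons_val_fin_one]
  match_scalars <;> ring

/-- **`Y₁ u^k = −(k−1)(n+1−k) u^{k−1} + u^{k+1}`** (`Y₁ = X_α − Y_α`). [cite: Kovacevic2021, §3 Def. 1] -/
theorem act_Y₁ (hρ : ActsOnKTypesTwist S e ρ𝔤) {X : (uFormGroup (Fin 2) (Fin 1)).compactLie}
    (hX : (X : Matrix (Fin 2 ⊕ Fin 1) (Fin 2 ⊕ Fin 1) ℂ) = Matrix.fromBlocks !![0, 1; -1, 0] 0 0 0)
    {n m k : ℤ} (hS : (n, m) ∈ S) (hk : 1 ≤ k) (hkn : k ≤ n) :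
    ρ𝔤 (LieSubalgebra.inclusion (uFormGroup (Fin 2) (Fin 1)).compactLie_le_lie X) (kvec S n m k) =
      (-(((k : ℂ) - 1) * ((n : ℂ) + 1 - k))) • kvec S n m (k - 1) + (1 : ℂ) • kvec S n m (k + 1) := by
  rw [hρ X n m k hS hk hkn, hX]
  simp only [Fin.isValue, Matrix.fromBlocks_apply₁₁, Matrix.fromBlocks_apply₂₂, Matrix.of_apply, Matrix.cons_val',
    Matrix.cons_val_zero, Matrix.cons_val_one, Matrix.cons_val_fin_one, Matrix.zero_apply]
  match_scalars <;> ring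

/-- **`Y₂ u^k = −i(k−1)(n+1−k) u^{k−1} − i u^{k+1}`** (`Y₂ = i(X_α + Y_α)`). [cite: Kovacevic2021, §3 Def. 1] -/
theorem act_Y₂ (hρ : ActsOnKTypesTwist S e ρ𝔤) {X : (uFormGroup (Fin 2) (Fin 1)).compactLie}
    (hX : (X : Matrix (Fin 2 ⊕ Fin 1) (Fin 2 ⊕ Fin 1) ℂ) = Matrix.fromBlocks !![0, I; I, 0] 0 0 0)
    {n m k : ℤ} (hS : (n, m) ∈ S) (hk : 1 ≤ k) (hkn : k ≤ n) :
    ρ𝔤 (LieSubalgebra.inclusion (uFormGroup (Fin 2) (Fin 1)).compactLie_le_lie X) (kvec S n m k) =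
      (-(I * (((k : ℂ) - 1) * ((n : ℂ) + 1 - k)))) • kvec S n m (k - 1) + (-I) • kvec S n m (k + 1) := by
  rw [hρ X n m k hS hk hkn, hX]
  simp only [Fin.isValue, Matrix.fromBlocks_apply₁₁, Matrix.fromBlocks_apply₂₂, Matrix.of_apply, Matrix.cons_val',
    Matrix.cons_val_zero, Matrix.cons_val_one, Matrix.cons_val_fin_one, Matrix.zero_apply]
  match_scalars <;> ring

/-- **The lowering combination `(Y₁ − iY₂) u^k = −2(k−1)(n+1−k) u^{k−1}`** (= `2X_α`; the scalar `−i` as `algebraMap`).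
[cite: Kovacevic2021, §3 Def. 1] -/
theorem act_lower (hρ : ActsOnKTypesTwist S e ρ𝔤) {Y₁ Y₂ : (uFormGroup (Fin 2) (Fin 1)).compactLie}
    (hY₁ : (Y₁ : Matrix (Fin 2 ⊕ Fin 1) (Fin 2 ⊕ Fin 1) ℂ) = Matrix.fromBlocks !![0, 1; -1, 0] 0 0 0)
    (hY₂ : (Y₂ : Matrix (Fin 2 ⊕ Fin 1) (Fin 2 ⊕ Fin 1) ℂ) = Matrix.fromBlocks !![0, I; I, 0] 0 0 0)
    {n m k : ℤ} (hS : (n, m) ∈ S) (hk : 1 ≤ k) (hkn : k ≤ n) :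
    (ρ𝔤 (LieSubalgebra.inclusion (uFormGroup (Fin 2) (Fin 1)).compactLie_le_lie Y₁)
        + algebraMap ℂ (Module.End ℂ (KIdx S →₀ ℂ)) (-I)
          * ρ𝔤 (LieSubalgebra.inclusion (uFormGroup (Fin 2) (Fin 1)).compactLie_le_lie Y₂)) (kvec S n m k) =
      (-(2 : ℂ) * (((k : ℂ) - 1) * ((n : ℂ) + 1 - k))) • kvec S n m (k - 1) := by
  simp only [LinearMap.add_apply, Module.End.mul_apply, act_Y₁ hρ hY₁ hS hk hkn, act_Y₂ hρ hY₂ hS hk hkn, map_add,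
    map_smul, Module.algebraMap_end_apply, smul_smul]
  match_scalars
  · linear_combination (((k : ℂ) - 1) * ((n : ℂ) + 1 - k)) * Complex.I_sq
  · linear_combination Complex.I_sq

/-- **The raising combination `(Y₁ + iY₂) u^k = 2 u^{k+1}`** (= `−2Y_α`; the scalar `i` as `algebraMap`).
[cite: Kovacevic2021, §3 Def. 1] -/
theorem act_raise (hρ : ActsOnKTypesTwist S e ρ𝔤) {Y₁ Y₂ : (uFormGroup (Fin 2) (Fin 1)).compactLie}
    (hY₁ : (Y₁ : Matrix (Fin 2 ⊕ Fin 1) (Fin 2 ⊕ Fin 1) ℂ) = Matrix.fromBlocks !![0, 1; -1, 0] 0 0 0)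
    (hY₂ : (Y₂ : Matrix (Fin 2 ⊕ Fin 1) (Fin 2 ⊕ Fin 1) ℂ) = Matrix.fromBlocks !![0, I; I, 0] 0 0 0)
    {n m k : ℤ} (hS : (n, m) ∈ S) (hk : 1 ≤ k) (hkn : k ≤ n) :
    (ρ𝔤 (LieSubalgebra.inclusion (uFormGroup (Fin 2) (Fin 1)).compactLie_le_lie Y₁)
        + algebraMap ℂ (Module.End ℂ (KIdx S →₀ ℂ)) I
          * ρ𝔤 (LieSubalgebra.inclusion (uFormGroup (Fin 2) (Fin 1)).compactLie_le_lie Y₂)) (kvec S n m k) =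
      (2 : ℂ) • kvec S n m (k + 1) := by
  simp only [LinearMap.add_apply, Module.End.mul_apply, act_Y₁ hρ hY₁ hS hk hkn, act_Y₂ hρ hY₂ hS hk hkn, map_add,
    map_smul, Module.algebraMap_end_apply, smul_smul]
  match_scalars
  · linear_combination (-(((k : ℂ) - 1) * ((n : ℂ) + 1 - k))) * Complex.I_sq
  · linear_combination (-1 : ℂ) * Complex.I_sq

/-! ## §3 The diagonal element `T = (Y₁ + iY₂)(Y₁ − iY₂) + H'² + 2iH' + Z'` of the `𝔨`-algebra -/

/-- **`(Y₁ + iY₂)(Y₁ − iY₂) u^k = −4(k−1)(n+1−k) u^k`** (for `k = 1` both sides vanish; for `k ≥ 2` the raising formula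
at `k − 1`). [cite: Kovacevic2021, §3 Def. 1] -/
theorem act_raise_lower (hρ : ActsOnKTypesTwist S e ρ𝔤) {Y₁ Y₂ : (uFormGroup (Fin 2) (Fin 1)).compactLie}
    (hY₁ : (Y₁ : Matrix (Fin 2 ⊕ Fin 1) (Fin 2 ⊕ Fin 1) ℂ) = Matrix.fromBlocks !![0, 1; -1, 0] 0 0 0)
    (hY₂ : (Y₂ : Matrix (Fin 2 ⊕ Fin 1) (Fin 2 ⊕ Fin 1) ℂ) = Matrix.fromBlocks !![0, I; I, 0] 0 0 0)
    {n m k : ℤ} (hS : (n, m) ∈ S) (hk : 1 ≤ k) (hkn : k ≤ n) :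
    ((ρ𝔤 (LieSubalgebra.inclusion (uFormGroup (Fin 2) (Fin 1)).compactLie_le_lie Y₁)
          + algebraMap ℂ (Module.End ℂ (KIdx S →₀ ℂ)) I
            * ρ𝔤 (LieSubalgebra.inclusion (uFormGroup (Fin 2) (Fin 1)).compactLie_le_lie Y₂))
      * (ρ𝔤 (LieSubalgebra.inclusion (uFormGroup (Fin 2) (Fin 1)).compactLie_le_lie Y₁)
          + algebraMap ℂ (Module.End ℂ (KIdx S →₀ ℂ)) (-I)
            * ρ𝔤 (LieSubalgebra.inclusion (uFormGroup (Fin 2) (Fin 1)).compactLie_le_lie Y₂))) (kvec S n m k) =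
      (-(4 : ℂ) * (((k : ℂ) - 1) * ((n : ℂ) + 1 - k))) • kvec S n m k := by
  rw [Module.End.mul_apply, act_lower hρ hY₁ hY₂ hS hk hkn, map_smul]
  rcases hk.eq_or_lt with rfl | hk2
  · simp
  · rw [act_raise hρ hY₁ hY₂ hS (by omega) (by omega), sub_add_cancel, smul_smul]
    congr 1
    ring

/-- **The eigenvalue of `T = (Y₁ + iY₂)(Y₁ − iY₂) + H'·H' + 2i·H' + Z'` on `u^k_{n,m}` is `(1 − n²) + i m`**:
`−4(k−1)(n+1−k) − (n+1−2k)² − 2(n+1−2k) = −(n−1)(n+1)` (the `𝔰𝔲(2)`-Casimir on `Sym^{n−1}`) plus `i m` from `Z'`.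
[cite: Kovacevic2021, §3 Def. 1] [cite: KnappVogan1995, §I.3 (before Prop. 1.63)] -/
theorem act_T (hρ : ActsOnKTypesTwist S e ρ𝔤) {H Z Y₁ Y₂ : (uFormGroup (Fin 2) (Fin 1)).compactLie}
    (hH : (H : Matrix (Fin 2 ⊕ Fin 1) (Fin 2 ⊕ Fin 1) ℂ) = Matrix.fromBlocks !![I, 0; 0, -I] 0 0 0)
    (hZ : (Z : Matrix (Fin 2 ⊕ Fin 1) (Fin 2 ⊕ Fin 1) ℂ) = Matrix.fromBlocks !![I, 0; 0, I] 0 0 !![-2 * I])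
    (hY₁ : (Y₁ : Matrix (Fin 2 ⊕ Fin 1) (Fin 2 ⊕ Fin 1) ℂ) = Matrix.fromBlocks !![0, 1; -1, 0] 0 0 0)
    (hY₂ : (Y₂ : Matrix (Fin 2 ⊕ Fin 1) (Fin 2 ⊕ Fin 1) ℂ) = Matrix.fromBlocks !![0, I; I, 0] 0 0 0)
    {n m k : ℤ} (hS : (n, m) ∈ S) (hk : 1 ≤ k) (hkn : k ≤ n) :
    ((ρ𝔤 (LieSubalgebra.inclusion (uFormGroup (Fin 2) (Fin 1)).compactLie_le_lie Y₁)
            + algebraMap ℂ (Module.End ℂ (KIdx S →₀ ℂ)) I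
              * ρ𝔤 (LieSubalgebra.inclusion (uFormGroup (Fin 2) (Fin 1)).compactLie_le_lie Y₂))
        * (ρ𝔤 (LieSubalgebra.inclusion (uFormGroup (Fin 2) (Fin 1)).compactLie_le_lie Y₁)
            + algebraMap ℂ (Module.End ℂ (KIdx S →₀ ℂ)) (-I)
              * ρ𝔤 (LieSubalgebra.inclusion (uFormGroup (Fin 2) (Fin 1)).compactLie_le_lie Y₂))
      + ρ𝔤 (LieSubalgebra.inclusion (uFormGroup (Fin 2) (Fin 1)).compactLie_le_lie H)
          * ρ𝔤 (LieSubalgebra.inclusion (uFormGroup (Fin 2) (Fin 1)).compactLie_le_lie H)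
      + algebraMap ℂ (Module.End ℂ (KIdx S →₀ ℂ)) (2 * I)
          * ρ𝔤 (LieSubalgebra.inclusion (uFormGroup (Fin 2) (Fin 1)).compactLie_le_lie H)
      + ρ𝔤 (LieSubalgebra.inclusion (uFormGroup (Fin 2) (Fin 1)).compactLie_le_lie Z)) (kvec S n m k) =
      ((1 - (n : ℂ) ^ 2) + I * (m : ℂ)) • kvec S n m k := by
  rw [LinearMap.add_apply, LinearMap.add_apply, LinearMap.add_apply, act_raise_lower hρ hY₁ hY₂ hS hk hkn]
  simp only [Module.End.mul_apply, act_H hρ hH hS hk hkn, act_Z hρ hZ hS hk hkn, map_smul, Module.algebraMap_end_apply,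
    smul_smul]
  match_scalars
  linear_combination (((n : ℂ) + 1 - 2 * k) ^ 2 + 2 * ((n : ℂ) + 1 - 2 * k)) * Complex.I_sq

/-- **`T` lies in the (associative, unital) subalgebra of `End V` generated by `ρ𝔤(𝔨)`** (its constituents are generators
and scalars `algebraMap ℂ _ c`). [cite: BorelWallach2000, 0 §2.5] -/
theorem T_mem_adjoin (H Z Y₁ Y₂ : (uFormGroup (Fin 2) (Fin 1)).compactLie) :
    ((ρ𝔤 (LieSubalgebra.inclusion (uFormGroup (Fin 2) (Fin 1)).compactLie_le_lie Y₁)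
            + algebraMap ℂ (Module.End ℂ (KIdx S →₀ ℂ)) I
              * ρ𝔤 (LieSubalgebra.inclusion (uFormGroup (Fin 2) (Fin 1)).compactLie_le_lie Y₂))
        * (ρ𝔤 (LieSubalgebra.inclusion (uFormGroup (Fin 2) (Fin 1)).compactLie_le_lie Y₁)
            + algebraMap ℂ (Module.End ℂ (KIdx S →₀ ℂ)) (-I)
              * ρ𝔤 (LieSubalgebra.inclusion (uFormGroup (Fin 2) (Fin 1)).compactLie_le_lie Y₂))
      + ρ𝔤 (LieSubalgebra.inclusion (uFormGroup (Fin 2) (Fin 1)).compactLie_le_lie H)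
          * ρ𝔤 (LieSubalgebra.inclusion (uFormGroup (Fin 2) (Fin 1)).compactLie_le_lie H)
      + algebraMap ℂ (Module.End ℂ (KIdx S →₀ ℂ)) (2 * I)
          * ρ𝔤 (LieSubalgebra.inclusion (uFormGroup (Fin 2) (Fin 1)).compactLie_le_lie H)
      + ρ𝔤 (LieSubalgebra.inclusion (uFormGroup (Fin 2) (Fin 1)).compactLie_le_lie Z)) ∈
      Algebra.adjoin ℂ (Set.range fun Y : (uFormGroup (Fin 2) (Fin 1)).compactLie =>
        ρ𝔤 (LieSubalgebra.inclusion (uFormGroup (Fin 2) (Fin 1)).compactLie_le_lie Y)) := by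
  have hgen : ∀ Y : (uFormGroup (Fin 2) (Fin 1)).compactLie,
      ρ𝔤 (LieSubalgebra.inclusion (uFormGroup (Fin 2) (Fin 1)).compactLie_le_lie Y) ∈
        Algebra.adjoin ℂ (Set.range fun Y : (uFormGroup (Fin 2) (Fin 1)).compactLie =>
          ρ𝔤 (LieSubalgebra.inclusion (uFormGroup (Fin 2) (Fin 1)).compactLie_le_lie Y)) :=
    fun Y => Algebra.subset_adjoin ⟨Y, rfl⟩
  refine Subalgebra.add_mem _ (Subalgebra.add_mem _ (Subalgebra.add_mem _ ?_ ?_) ?_) (hgen Z)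
  · exact Subalgebra.mul_mem _
      (Subalgebra.add_mem _ (hgen Y₁) (Subalgebra.mul_mem _ (Subalgebra.algebraMap_mem _ _) (hgen Y₂)))
      (Subalgebra.add_mem _ (hgen Y₁) (Subalgebra.mul_mem _ (Subalgebra.algebraMap_mem _ _) (hgen Y₂)))
  · exact Subalgebra.mul_mem _ (hgen H) (hgen H)
  · exact Subalgebra.mul_mem _ (Subalgebra.algebraMap_mem _ _) (hgen H)

end Action

/-! ## §4 The fibres of the eigenvalue `(n, m, k) ↦ (1 − n²) + i m` on `KIdx S` are finite -/

/-- On labels with `n, n' ≥ 1`, `(1 − n²) + i m = (1 − n'²) + i m'` forces `n = n'` and `m = m'` (real and imaginary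
parts; `n ↦ n²` is injective on `n ≥ 1`). [folklore] -/
theorem eq_of_eigenvalue_eq {n m n' m' : ℤ} (hn : 1 ≤ n) (hn' : 1 ≤ n')
    (h : (1 - (n : ℂ) ^ 2) + I * (m : ℂ) = (1 - (n' : ℂ) ^ 2) + I * (m' : ℂ)) : n = n' ∧ m = m' := by
  have hre := congrArg Complex.re h
  have him := congrArg Complex.im h
  simp only [Complex.add_re, Complex.sub_re, Complex.one_re, Complex.mul_re, Complex.I_re, Complex.I_im,
    Complex.add_im, Complex.sub_im, Complex.one_im, Complex.mul_im, ← Complex.ofReal_intCast, ← Complex.ofReal_pow,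
    Complex.ofReal_re, Complex.ofReal_im, zero_mul, one_mul, mul_zero, sub_zero, add_zero, zero_add] at hre him
  refine ⟨?_, by exact_mod_cast him⟩
  have hsq : (n : ℝ) ^ 2 = (n' : ℝ) ^ 2 := by linarith
  have hsq' : n ^ 2 = n' ^ 2 := by exact_mod_cast hsq
  have hprod : (n - n') * (n + n') = 0 := by linear_combination hsq'
  rcases mul_eq_zero.1 hprod with h0 | h0 <;> omega

/-- **Finite fibres**: for every `c₀`, only finitely many labels `(n, m, k) ∈ KIdx S` (`1 ≤ k ≤ n`) have
`(1 − n²) + i m = c₀` — `(n, m)` is determined (`n ≥ 1`) and `k ∈ [1, n]`. [folklore] -/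
theorem finite_fibre (S : Set (ℤ × ℤ)) (c₀ : ℂ) :
    Set.Finite {t : KIdx S | (1 - (t.1.1 : ℂ) ^ 2) + I * (t.1.2.1 : ℂ) = c₀} := by
  by_cases hne : Set.Nonempty {t : KIdx S | (1 - (t.1.1 : ℂ) ^ 2) + I * (t.1.2.1 : ℂ) = c₀}
  · obtain ⟨t₀, ht₀⟩ := hne
    have key : ∀ t ∈ {t : KIdx S | (1 - (t.1.1 : ℂ) ^ 2) + I * (t.1.2.1 : ℂ) = c₀},
        t.1.1 = t₀.1.1 ∧ t.1.2.1 = t₀.1.2.1 := fun t ht =>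
      eq_of_eigenvalue_eq (le_trans t.2.2.1 t.2.2.2) (le_trans t₀.2.2.1 t₀.2.2.2) (ht.trans ht₀.symm)
    refine Set.Finite.of_finite_image (f := fun t : KIdx S => t.1.2.2) ?_ ?_
    · refine (Set.finite_Icc 1 t₀.1.1).subset ?_
      rintro _ ⟨t, ht, rfl⟩
      exact ⟨t.2.2.1, (key t ht).1 ▸ t.2.2.2⟩
    · intro t ht t' ht' hk
      obtain ⟨hn, hm⟩ := key t ht
      obtain ⟨hn', hm'⟩ := key t' ht'
      exact Subtype.ext (Prod.ext (hn.trans hn'.symm) (Prod.ext (hm.trans hm'.symm) hk))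
  · rw [Set.not_nonempty_iff_eq_empty.1 hne]
    exact Set.finite_empty

/-! ## §5 The head -/

/-- **PAYMENT OF `sig_K2E1bTwistAdmissible`** (socket #6 of unit U0 of the K2_E1b road,
`Cruxes/H413/Lines/K2_E1b_GKCohomologyU21_U0_TwistIntegration.lean`, TOKEN FOR TOKEN): a `(𝔤, K)`-module of `U(2,1)`
on `V = ⊕_{(n,m) ∈ S} V_{n,m}` whose `𝔨`-action is given by Kovačević's twisted `u`-basis formulas is ADMISSIBLE — the
element `T = (Y₁ + iY₂)(Y₁ − iY₂) + H'² + 2iH' + Z'` of the `𝔨`-algebra is diagonal on the basis `u^k_{n,m}` with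
eigenvalue `(1 − n²) + i m` (§3), whose fibres are finite (§4), so every compatible `K`-action has finite `K`-type
multiplicities (★ `IsGKModule.isAdmissibleGK_of_basis_eigenvector`).  (The hypotheses «`1 ≤ n` on `S`» and
«`ρK` preserves the `K`-types» of the socket are not used.)
[cite: BorelWallach2000, 0 §2.5] [cite: KnappVogan1995, §I.3 (before Prop. 1.63)] [cite: Kovacevic2021, §3 Def. 1] -/
theorem twistAdmissible :
    ∀ (S : Set (ℤ × ℤ)) (e : ℤ) (ρK : Representation ℂ (uFormGroup (Fin 2) (Fin 1)).maximalCompact (KIdx S →₀ ℂ))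
      (ρ𝔤 : (uFormGroup (Fin 2) (Fin 1)).lie →ₗ⁅ℝ⁆ Module.End ℂ (KIdx S →₀ ℂ)),
      (∀ n m : ℤ, (n, m) ∈ S → 1 ≤ n) → IsGKModule (uFormGroup (Fin 2) (Fin 1)) ρK ρ𝔤 → ActsOnKTypesTwist S e ρ𝔤 →
        (∀ (g : (uFormGroup (Fin 2) (Fin 1)).maximalCompact) (n m k : ℤ),
          ρK g (kvec S n m k) ∈ Submodule.span ℂ (Set.range fun l : ℤ => kvec S n m l)) →
        IsAdmissibleGK ρK := by
  intro S e ρK ρ𝔤 _ hGK hρ _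
  obtain ⟨H, hH⟩ := exists_compactLie_H
  obtain ⟨Z, hZ⟩ := exists_compactLie_Z
  obtain ⟨Y₁, hY₁⟩ := exists_compactLie_Y₁
  obtain ⟨Y₂, hY₂⟩ := exists_compactLie_Y₂
  refine hGK.isAdmissibleGK_of_basis_eigenvector (T_mem_adjoin H Z Y₁ Y₂) Finsupp.basisSingleOne
    (fun t : KIdx S => (1 - (t.1.1 : ℂ) ^ 2) + I * (t.1.2.1 : ℂ)) (fun t => ?_) (finite_fibre S)
  simp only [Finsupp.coe_basisSingleOne, single_eq_kvec]
  exact act_T hρ hH hZ hY₁ hY₂ t.2.1 t.2.2.1 t.2.2.2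

end Summit.HodgeConjecture.HodgeConjecture.Cruxes.H413.K2E1bTwistAdmissible

end
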